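import Summits.Ventures.DiscreteObjects.Hadamard.InvolutionCensus668

/-!
# Hadamard 668 census, family F12 — the weighing-matrix / determinant refinement of the involution census: `4 ∣ f` (kernel)

Framing: lottery ticket; floor = certified bounds/negative ranges.

Cell pub-namedobj (venture DiscreteObjects), target (H), hadamard gen 12.  Companion of `InvolutionCensus668`.  Classical fact
(weighing-matrix folklore; e.g. the 'W(n,k) with n odd forces k square' determinant argument of Geramita–Seberry): if a Hadamard
matrix `H` of order `n` has a signed involution `(π, κ, d, e)` of TYPE I (a fixed row and a fixed column, hence type `ε = +1` and
one common fixed sign `δ`), then with `f = #Fix π = #Fix κ` and `t = (n − f)/2` the `t × t` matrix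
`B k j = H k j − δ e j H k (κ j)` (row representatives `k < π k` × column representatives `j < κ j`, entries `0, ±2`) satisfies
`B Bᵀ = n I_t` (`invRep_row_orth`, entrywise): the row-pair orthogonality `Σ_j e j H k j H l (κ j) = 0` for representatives
`k, l` kills the cross terms, and the fixed-column contributions `∓ F_{kl}` cancel because `δ² = 1`.  Hence `det(B)² = n^t`, and
**if `n` is not a perfect square then `t` is even, i.e. `4 ∣ n − f`** (`involution_typeI_four_dvd`).  (`B/2` is a weighing matrix
`W(t, n/4)`.)  For `n = 668`: in type I of `hadamard668_involution_census` the number of fixed rows is a multiple of `4` in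
`[4, 332]` (`hadamard668_involution_typeI_mod4`).  Ours (formalisation), classical content; no `sorry`.
-/

namespace Summit.Ventures.DiscreteObjects.Hadamard

open Finset BigOperators Matrix

open Literature.Combinatorics.Designs.GoethalsSeidel (IsHadamardMatrix)

variable {ι : Type*} [Fintype ι] [DecidableEq ι]

section reps
variable [LinearOrder ι]

/-- the image under a pointwise involution of the 'small' representatives of its pairs is the set of 'large' ones -/
lemma image_reps_invol (κ : Equiv.Perm ι) (hκ : ∀ j, κ (κ j) = j) :
    (univ.filter fun j => κ j ≠ j ∧ j < κ j).image κ = univ.filter fun j => κ j ≠ j ∧ κ j < j := by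
  ext j
  simp only [Finset.mem_image, Finset.mem_filter, Finset.mem_univ, true_and]
  constructor
  · rintro ⟨j₀, ⟨h1, h2⟩, rfl⟩
    rw [hκ j₀]
    exact ⟨Ne.symm h1, h2⟩
  · rintro ⟨h1, h2⟩
    exact ⟨κ j, ⟨by rw [hκ j]; exact Ne.symm h1, by rw [hκ j]; exact h2⟩, hκ j⟩

/-- **pair sums via representatives**: `Σ_{reps} (g j + g (κ j)) = Σ_{moved} g j` -/
lemma sum_reps_pair (κ : Equiv.Perm ι) (hκ : ∀ j, κ (κ j) = j) (g : ι → ℤ) :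
    ∑ j ∈ univ.filter (fun j => κ j ≠ j ∧ j < κ j), (g j + g (κ j)) = ∑ j ∈ univ.filter (fun j => κ j ≠ j), g j := by
  rw [Finset.sum_add_distrib]
  have h2 : ∑ j ∈ univ.filter (fun j => κ j ≠ j ∧ j < κ j), g (κ j) = ∑ j ∈ univ.filter (fun j => κ j ≠ j ∧ κ j < j), g j := by
    rw [← image_reps_invol κ hκ, Finset.sum_image (fun x _ y _ h => κ.injective h)]
  rw [h2, ← Finset.sum_union]
  · congr 1
    ext j
    simp only [Finset.mem_union, Finset.mem_filter, Finset.mem_univ, true_and]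
    constructor
    · rintro (⟨h, -⟩ | ⟨h, -⟩) <;> exact h
    · intro h
      rcases lt_or_gt_of_ne (Ne.symm h) with h' | h'
      · exact Or.inl ⟨h, h'⟩
      · exact Or.inr ⟨h, h'⟩
  · rw [Finset.disjoint_left]
    intro j h1 h2
    simp only [Finset.mem_filter, Finset.mem_univ, true_and] at h1 h2
    exact lt_asymm h1.2 h2.2

/-- twice the number of representatives is the number of moved points -/
lemma two_mul_card_reps (κ : Equiv.Perm ι) (hκ : ∀ j, κ (κ j) = j) :
    2 * (univ.filter fun j => κ j ≠ j ∧ j < κ j).card = (univ.filter fun j => κ j ≠ j).card := by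
  have h := sum_reps_pair κ hκ (fun _ => 1)
  simp only [Finset.sum_const, mul_one, nsmul_eq_mul] at h
  push_cast at h
  omega

end reps

section weighing
variable [LinearOrder ι] {H : Matrix ι ι ℤ} {π κ : Equiv.Perm ι} {d e : ι → ℤ}

/-- **`B Bᵀ = n I`, entrywise**: for row representatives `k, l` (`k < π k`, `l < π l`) of a signed involution pair with a fixed row
`r₀` (`δ = d r₀`), `Σ_{j < κ j} (H k j − δ e j H k (κ j)) (H l j − δ e j H l (κ j)) = n [k = l]`. -/
theorem invRep_row_orth (hH : IsHadamardMatrix H) (haut : IsSignedAut H π κ d e)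
    (hπinv : ∀ i, π (π i) = i) (hκinv : ∀ j, κ (κ j) = j) {r₀ : ι} (hr₀ : π r₀ = r₀)
    {k l : ι} (hk : π k ≠ k ∧ k < π k) (hl : π l ≠ l ∧ l < π l) :
    ∑ j ∈ univ.filter (fun j => κ j ≠ j ∧ j < κ j), (H k j - d r₀ * e j * H k (κ j)) * (H l j - d r₀ * e j * H l (κ j))
      = if k = l then (Fintype.card ι : ℤ) else 0 := by
  have hd := haut.1
  have he := haut.2.1
  have hA := haut.2.2
  set δ := d r₀ with hδdef
  have hδδ : δ * δ = 1 := pm_mul_self (hd r₀)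
  have heδ : ∀ j, κ j = j → e j = δ := fun j hj => (signedAut_fixed_sign hH.1 haut hr₀ hj).symm
  have heinv : ∀ j, e (κ j) = e j := by
    intro j
    have h := signedAut_sq_sign hH.1 haut hπinv hκinv r₀ j
    rw [hr₀, pm_mul_self (hd r₀), one_mul] at h
    exact (pm_eq_of_mul_eq_one (he j) (he (κ j)) h).symm
  -- the key vanishing: Σ_j e j H k j H l (κ j) = 0 for representatives k, l
  have hP : ∑ j, e j * (H k j * H l (κ j)) = 0 := by
    have hne : π l ≠ k := by
      intro h
      have : π k = l := by rw [← h, hπinv l]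
      have h1 := hl.2; have h2 := hk.2
      rw [h] at h1; rw [this] at h2
      exact lt_asymm h2 h1
    have orth : ∑ j, H (π l) (κ j) * H k (κ j) = 0 := by
      rw [Fintype.sum_equiv κ (fun j => H (π l) (κ j) * H k (κ j)) (fun j => H (π l) j * H k j) (fun j => rfl)]
      exact hadamard_row_orth H hH hne
    rw [Finset.sum_congr rfl fun j _ => by rw [hA l j]] at orth
    have e1 : ∑ j, d l * e j * H l j * H k (κ j) = d l * ∑ j, e j * (H l j * H k (κ j)) := by
      rw [Finset.mul_sum]; exact Finset.sum_congr rfl fun j _ => by ring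
    rw [e1] at orth
    rcases mul_eq_zero.mp orth with h0 | h0
    · exact absurd h0 (pm_ne_zero (hd l))
    · rw [← h0, ← Fintype.sum_equiv κ (fun j => e (κ j) * (H l (κ j) * H k (κ (κ j)))) (fun j => e j * (H l j * H k (κ j)))
        (fun j => rfl)]
      exact Finset.sum_congr rfl fun j _ => by rw [heinv j, hκinv j]; ring
  -- expand the product: (g j + g (κ j)) − δ (e·h j + e·h (κ j))
  have hexp : ∀ j ∈ univ.filter (fun j => κ j ≠ j ∧ j < κ j),
      (H k j - δ * e j * H k (κ j)) * (H l j - δ * e j * H l (κ j))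
        = (H k j * H l j + H k (κ j) * H l (κ j)) - δ * (e j * (H k j * H l (κ j)) + e (κ j) * (H k (κ j) * H l (κ (κ j)))) := by
    intro j _
    have := pm_mul_self (he j)
    rw [heinv j, hκinv j]
    calc (H k j - δ * e j * H k (κ j)) * (H l j - δ * e j * H l (κ j))
        = H k j * H l j + (δ * δ) * (e j * e j) * (H k (κ j) * H l (κ j))
          - δ * (e j * (H k j * H l (κ j)) + e j * (H k (κ j) * H l j)) := by ring
      _ = _ := by rw [hδδ, this]; ring
  rw [Finset.sum_congr rfl hexp, Finset.sum_sub_distrib, ← Finset.mul_sum,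
    sum_reps_pair κ hκinv (fun j => H k j * H l j), sum_reps_pair κ hκinv (fun j => e j * (H k j * H l (κ j)))]
  -- moved sums = total − fixed
  have htot1 := Finset.sum_filter_add_sum_filter_not univ (fun j => κ j = j) (fun j => H k j * H l j)
  have htot2 := Finset.sum_filter_add_sum_filter_not univ (fun j => κ j = j) (fun j => e j * (H k j * H l (κ j)))
  have eC : (univ.filter fun j => κ j ≠ j) = univ.filter (fun j => ¬ κ j = j) := rfl
  have hfix2 : ∑ j ∈ univ.filter (fun j => κ j = j), e j * (H k j * H l (κ j))
      = δ * ∑ j ∈ univ.filter (fun j => κ j = j), H k j * H l j := by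
    rw [Finset.mul_sum]
    refine Finset.sum_congr rfl fun j hj => ?_
    have hj' : κ j = j := by simpa using hj
    rw [hj', heδ j hj']
  rw [hP, hfix2] at htot2
  have hall : ∑ j, H k j * H l j = if k = l then (Fintype.card ι : ℤ) else 0 := by
    split_ifs with h
    · rw [h]; exact hadamard_row_self H hH l
    · exact hadamard_row_orth H hH h
  rw [hall] at htot1
  rw [eC]
  have e2 : ∑ j ∈ univ.filter (fun j => ¬ κ j = j), e j * (H k j * H l (κ j))
      = -(δ * ∑ j ∈ univ.filter (fun j => κ j = j), H k j * H l j) := by linarith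
  have e3 : ∑ j ∈ univ.filter (fun j => ¬ κ j = j), H k j * H l j
      = (if k = l then (Fintype.card ι : ℤ) else 0) - ∑ j ∈ univ.filter (fun j => κ j = j), H k j * H l j := by linarith
  rw [e2, e3]
  calc (if k = l then (Fintype.card ι : ℤ) else 0) - ∑ j ∈ univ.filter (fun j => κ j = j), H k j * H l j
        - δ * -(δ * ∑ j ∈ univ.filter (fun j => κ j = j), H k j * H l j)
      = (if k = l then (Fintype.card ι : ℤ) else 0)
        + (δ * δ - 1) * ∑ j ∈ univ.filter (fun j => κ j = j), H k j * H l j := by ring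
    _ = if k = l then (Fintype.card ι : ℤ) else 0 := by rw [hδδ]; ring

omit [LinearOrder ι] in
/-- equal numbers of fixed rows and fixed columns in type I (trace lemma with one common sign) -/
lemma card_fixed_eq_typeI (hH : IsHadamardMatrix H) (hcard : (Fintype.card ι : ℤ) ≠ 0) (haut : IsSignedAut H π κ d e)
    {r₀ c₀ : ι} (hr₀ : π r₀ = r₀) (hc₀ : κ c₀ = c₀) :
    (univ.filter fun i => π i = i).card = (univ.filter fun j => κ j = j).card := by
  have heδ : ∀ j, κ j = j → e j = d r₀ := fun j hj => (signedAut_fixed_sign hH.1 haut hr₀ hj).symm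
  have hdδ : ∀ i, π i = i → d i = d r₀ := by
    intro i hi; rw [signedAut_fixed_sign hH.1 haut hi hc₀, heδ c₀ hc₀]
  have htr := signedAut_trace hH hcard haut
  rw [Finset.sum_congr rfl fun i hi => hdδ i (by simpa using hi), Finset.sum_congr rfl fun j hj => heδ j (by simpa using hj),
    Finset.sum_const, Finset.sum_const, nsmul_eq_mul, nsmul_eq_mul] at htr
  have h := mul_right_cancel₀ (pm_ne_zero (haut.1 r₀)) htr
  exact_mod_cast h

/-- **Type I forces `4 ∣ n − f` when `n` is not a square** (ordered index type). -/
theorem involution_typeI_four_dvd_ord (hH : IsHadamardMatrix H) (hns : ¬ IsSquare (Fintype.card ι))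
    (haut : IsSignedAut H π κ d e) (hπinv : ∀ i, π (π i) = i) (hκinv : ∀ j, κ (κ j) = j)
    {r₀ c₀ : ι} (hr₀ : π r₀ = r₀) (hc₀ : κ c₀ = c₀) :
    4 ∣ (univ.filter fun i => π i ≠ i).card := by
  have hcard : (Fintype.card ι : ℤ) ≠ 0 := by
    have : 0 < Fintype.card ι := Fintype.card_pos_iff.mpr ⟨r₀⟩
    exact_mod_cast this.ne'
  set R := univ.filter (fun k => π k ≠ k ∧ k < π k) with hRdef
  set C := univ.filter (fun j => κ j ≠ j ∧ j < κ j) with hCdef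
  have hRC : R.card = C.card := by
    have h1 := two_mul_card_reps π hπinv
    have h2 := two_mul_card_reps κ hκinv
    have hsR := Finset.card_filter_add_card_filter_not (s := (univ : Finset ι)) (fun i => π i = i)
    have hsC := Finset.card_filter_add_card_filter_not (s := (univ : Finset ι)) (fun j => κ j = j)
    have hfeq := card_fixed_eq_typeI hH hcard haut hr₀ hc₀
    have eR : (univ.filter fun i => π i ≠ i) = univ.filter (fun i => ¬ π i = i) := rfl
    have eC : (univ.filter fun j => κ j ≠ j) = univ.filter (fun j => ¬ κ j = j) := rfl
    rw [eR] at h1; rw [eC] at h2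
    rw [hRdef, hCdef]; omega
  -- square reindexing of B k j = H k j − δ e j H k (κ j)
  have hcardRC : Fintype.card {j // j ∈ C} = Fintype.card {k // k ∈ R} := by
    rw [Fintype.card_coe, Fintype.card_coe, hRC]
  obtain ⟨σ⟩ : Nonempty ({j // j ∈ C} ≃ {k // k ∈ R}) := Fintype.card_eq.mp hcardRC
  set M : Matrix {k // k ∈ R} {k // k ∈ R} ℤ :=
    fun k l => H k.1 (σ.symm l).1 - d r₀ * e (σ.symm l).1 * H k.1 (κ (σ.symm l).1) with hMdef
  have hMM : M * Mᵀ = (Fintype.card ι : ℤ) • 1 := by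
    ext k l
    have hk : π k.1 ≠ k.1 ∧ k.1 < π k.1 := (Finset.mem_filter.mp k.2).2
    have hl : π l.1 ≠ l.1 ∧ l.1 < π l.1 := (Finset.mem_filter.mp l.2).2
    have hkl := invRep_row_orth hH haut hπinv hκinv hr₀ hk hl
    rw [Matrix.mul_apply, Matrix.smul_apply, smul_eq_mul, Matrix.one_apply]
    simp only [hMdef, Matrix.transpose_apply]
    rw [Equiv.sum_comp σ.symm (fun j : {j // j ∈ C} =>
      (H k.1 j.1 - d r₀ * e j.1 * H k.1 (κ j.1)) * (H l.1 j.1 - d r₀ * e j.1 * H l.1 (κ j.1)))]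
    rw [Finset.sum_coe_sort C (fun j => (H k.1 j - d r₀ * e j * H k.1 (κ j)) * (H l.1 j - d r₀ * e j * H l.1 (κ j))),
      hCdef, hkl]
    by_cases h : k = l
    · subst h; simp
    · have h' : k.1 ≠ l.1 := fun hh => h (Subtype.ext hh)
      rw [if_neg h', if_neg h, mul_zero]
  have hdet : M.det ^ 2 = (Fintype.card ι : ℤ) ^ Fintype.card {k // k ∈ R} := by
    have h := congrArg Matrix.det hMM
    rw [Matrix.det_mul, Matrix.det_transpose, Matrix.det_smul, Matrix.det_one, mul_one] at h
    rw [← h]; ring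
  -- t := #R; if t were odd, n would be a square
  rw [Fintype.card_coe] at hdet
  have h2t : 2 * R.card = (univ.filter fun i => π i ≠ i).card := two_mul_card_reps π hπinv
  by_contra h4
  have hodd : ¬ 2 ∣ R.card := by
    intro ⟨s, hs⟩; exact h4 ⟨s, by omega⟩
  obtain ⟨s, hs⟩ : ∃ s, R.card = 2 * s + 1 := ⟨R.card / 2, by omega⟩
  rw [hs] at hdet
  -- in ℕ: a² = n^(2s+1)
  set n := Fintype.card ι with hndef
  have hnat : M.det.natAbs ^ 2 = n ^ (2 * s + 1) := by
    have h1 : ((M.det.natAbs ^ 2 : ℕ) : ℤ) = ((n ^ (2 * s + 1) : ℕ) : ℤ) := by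
      push_cast
      rw [sq_abs, ← hdet]
    exact_mod_cast h1
  -- n^s ∣ |det|, and the cofactor squares to n
  have hdvd : n ^ s ∣ M.det.natAbs := by
    have : (n ^ s) ^ 2 ∣ M.det.natAbs ^ 2 := by
      rw [hnat, ← pow_mul, pow_succ]
      exact Dvd.intro _ (by ring)
    exact (Nat.pow_dvd_pow_iff two_ne_zero).mp this
  obtain ⟨c, hc⟩ := hdvd
  have hn0 : n ≠ 0 := by
    intro h; rw [hndef] at h; exact hcard (by rw [← hndef] at *; exact_mod_cast h)
  have hcsq : n = c * c := by
    have h1 : (n ^ s) ^ 2 * (c * c) = (n ^ s) ^ 2 * n := by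
      calc (n ^ s) ^ 2 * (c * c) = (n ^ s * c) ^ 2 := by ring
        _ = n ^ (2 * s + 1) := by rw [← hc, hnat]
        _ = (n ^ s) ^ 2 * n := by ring
    have hpos : 0 < (n ^ s) ^ 2 := by positivity
    exact (Nat.eq_of_mul_eq_mul_left hpos h1).symm
  exact hns ⟨c, hcsq⟩

end weighing

section general
variable {H : Matrix ι ι ℤ} {π κ : Equiv.Perm ι} {d e : ι → ℤ}

/-- **Type I forces `4 ∣ n − f` when the order `n` is not a square.**  For a Hadamard matrix of order `n = |ι|` and a signed
automorphism `(π, κ, d, e)` with `π² = κ² = 1` pointwise having a fixed row and a fixed column, the number of moved rows is a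
multiple of `4`. -/
theorem involution_typeI_four_dvd (hH : IsHadamardMatrix H) (hns : ¬ IsSquare (Fintype.card ι))
    (haut : IsSignedAut H π κ d e) (hπinv : ∀ i, π (π i) = i) (hκinv : ∀ j, κ (κ j) = j)
    (hr : ∃ i, π i = i) (hc : ∃ j, κ j = j) :
    4 ∣ (univ.filter fun i => π i ≠ i).card := by
  classical
  letI : LinearOrder ι := LinearOrder.lift' (Fintype.equivFin ι) (Fintype.equivFin ι).injective
  obtain ⟨r₀, hr₀⟩ := hr
  obtain ⟨c₀, hc₀⟩ := hc
  convert involution_typeI_four_dvd_ord hH hns haut hπinv hκinv hr₀ hc₀ using 2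

/-- **H(668), type I: the number of fixed rows is a multiple of 4 in `[4, 332]`.** -/
theorem hadamard668_involution_typeI_mod4 (hH : IsHadamardMatrix H) (hι : Fintype.card ι = 668)
    (π κ : Equiv.Perm ι) (d e : ι → ℤ) (haut : IsSignedAut H π κ d e)
    (hπ : π ^ 2 = 1) (hκ : κ ^ 2 = 1) (hne : π ≠ 1 ∨ κ ≠ 1) (hr : ∃ i, π i = i) (hc : ∃ j, κ j = j) :
    4 ∣ (univ.filter fun i => π i = i).card ∧ 4 ≤ (univ.filter fun i => π i = i).card ∧
      (univ.filter fun i => π i = i).card ≤ 332 ∧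
      (univ.filter fun i => π i = i).card = (univ.filter fun j => κ j = j).card := by
  have hπinv : ∀ i, π (π i) = i := fun i => by
    have := congrArg (fun σ : Equiv.Perm ι => σ i) hπ; simpa [pow_two] using this
  have hκinv : ∀ j, κ (κ j) = j := fun j => by
    have := congrArg (fun σ : Equiv.Perm ι => σ j) hκ; simpa [pow_two] using this
  have hns : ¬ IsSquare (Fintype.card ι) := by
    rw [hι]
    rintro ⟨c, hc⟩
    rcases le_or_gt c 25 with h | h
    · nlinarith
    · nlinarith
  have h4 := involution_typeI_four_dvd hH hns haut hπinv hκinv hr hc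
  obtain ⟨hπ1, -, hcases⟩ := hadamard668_involution_census hH hι π κ d e haut hπ hκ hne
  have hsplit := Finset.card_filter_add_card_filter_not (s := (univ : Finset ι)) (fun i => π i = i)
  rw [Finset.card_univ, hι] at hsplit
  have eR : (univ.filter fun i => π i ≠ i) = univ.filter (fun i => ¬ π i = i) := rfl
  rw [eR] at h4
  obtain ⟨r₀, hr₀⟩ := hr
  obtain ⟨c₀, hc₀⟩ := hc
  have hposr : 0 < (univ.filter fun i => π i = i).card := Finset.card_pos.mpr ⟨r₀, by simp [hr₀]⟩
  have hposc : 0 < (univ.filter fun j => κ j = j).card := Finset.card_pos.mpr ⟨c₀, by simp [hc₀]⟩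
  rcases hcases with ⟨h1, -, -, h4', -⟩ | ⟨h0, -, -⟩ | ⟨-, h0, -⟩ | ⟨h0, -⟩
  · obtain ⟨a, ha⟩ := h4
    exact ⟨⟨167 - a, by omega⟩, by omega, h4', h1⟩
  · omega
  · omega
  · omega

end general

end Summit.Ventures.DiscreteObjects.Hadamard
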